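import Summits.MatrixMultiplication.MatrixMultiplication.Theorems.ObstructionDescentLeviWeylLaw
import Summits.MatrixMultiplication.MatrixMultiplication.Theorems.ObstructionDescentWitnessPoints

set_option linter.dupNamespace false

/-!
# The corner law: rectangular weight vectors see only the corner; passing = witnessed (decomp-mm · lens 3 · gen 13, part 3)

Route `route-MatrixMultiplication-ObstructionDescent`, support for the aside `InvariantSaturation` (item
`stmt-MatrixMultiplication-32282`); continues `ObstructionDescentLeviWeylLaw` (restriction of a weight vector to a line).

A weight vector `f` of RECTANGULAR type `rectType m N k` (exponent `k` on the corner `{a | m ≤ a + N}`, exponent `0` before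
it) carries torus weight `0` on every off-corner index, so its value at a tensor `x` depends only on the corner block of
`x`: `f((P,P,P)·x) = f(x)` with `P = lastProj m N` the corner projection (`evalT_cornerProj`).  Proof without expanding
monomials: the one-parameter diagonal `D_t = 1 + (t−1)(1−P)` (entries `1` on the corner, `t` off it) is Borel with
character `1` for `t ≠ 0`, so the polynomial `t ↦ f(D_t ·_s x)` is constant on `ℂ^×`, hence at `t = 0`, where
`D_0 = P` (Laurent rigidity of Part 1 with a constant partner).
Consequence — THE WITNESS PRINCIPLE IS AN EQUIVALENCE (`mem_passLevels_iff_exists_cornerCols`): a level `k` passes at the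
cell `(m, N)` (some level-`k` weight vector survives on `σ_m = closure GL_m³·⟨m⟩`) IFF some level-`k` weight vector is
non-zero at a CORNER-SUPPORTED point `[PA|PB|PC]` of rank `≤ m` — the hand dictionary «`k ∈ passLevels m N ⟺
r_N(k) ≤ m`» (`r_N(k)` := least rank of a format-`N` tensor at which level `k` is non-zero) of NODE-g11/g12, so the
level censuses are complete in principle: every passing level HAS a rank-`≤ m` format-`N` witness; in the Literature's
`tensorRank` currency (`mem_passLevels_iff_exists_tensorRank_le`, corner format = the subtype `{a // m ≤ a + N}`):
`k ∈ passLevels m N ↔ ∃ w, tensorRank w ≤ m ∧ k ∈ pointLevels N (padTensor Subtype.val w)`.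
All hypotheses inline; no proposition defined; no `sorry`; standard axioms.  Nothing here proves `ω = 2`.
[cite: BurgisserIkenmeyer2011, §3.1–3.2, Lemma 3.2; BurgisserIkenmeyer2017, §5 (5.2), Thm 5.3]
-/

noncomputable section

open scoped BigOperators
open Finset

namespace Summit.MatrixMultiplication.MatrixMultiplication.Theorems.ObstructionCalculus

open Literature.Computability.AlgebraicComplexity (actTensor actTensor_actTensor unitTensor triad triad_apply tensorRank
  tensorRank_le_of_eq_sum)

section CornerLaw

variable {m : ℕ}

/-- The corner dilation `D_t` (diagonal: `1` on the corner, `t` off it) is `1 + (t − 1)·(1 − P)`, `P = lastProj m N`.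
[bookkeeping] -/
theorem diagonal_corner_eq (N : ℕ) (t : ℂ) :
    Matrix.diagonal (fun a : Fin m => if m ≤ (a : ℕ) + N then (1 : ℂ) else t) =
      1 + (t - 1) • (1 - lastProj m N) := by
  ext a b
  by_cases hab : a = b
  · subst hab
    by_cases hc : m ≤ (a : ℕ) + N <;> simp [lastProj, hc]
  · simp [lastProj, hab, Matrix.one_apply_ne hab]

/-- `D_t` has character `1` on every rectangular type (`1^k` on the corner, `t^0` off it). [bookkeeping] -/
theorem weightChar_rectType_cornerDiagonal (N k : ℕ) (s : Fin 3) (t : ℂ) :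
    weightChar (rectType m N k s) (Matrix.diagonal fun a : Fin m => if m ≤ (a : ℕ) + N then (1 : ℂ) else t) = 1 := by
  rw [weightChar_diagonal]
  refine Finset.prod_eq_one fun a _ => ?_
  by_cases hc : m ≤ (a : ℕ) + N <;> simp [rectType, hc]

/-- **Corner law, one slot.**  A rectangular weight vector is unchanged when slot `s` of the argument is projected onto
the corner: `f(P ·_s x) = f(x)`. [this node] -/
theorem evalT_slotAct_lastProj {N k d : ℕ} {f : MvPolynomial (Idx m) ℂ} (hf : f ∈ hwvSpace (rectType m N k) d)
    (s : Fin 3) (x : Tensor ℂ m) : evalT (slotAct s (lastProj m N) x) f = evalT x f := by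
  set y : Tensor ℂ m := slotAct s (1 - lastProj m N) x with hy
  obtain ⟨Q, hQ⟩ := exists_polynomial_evalT_line f x y
  -- for `t ≠ 0`: `f(D_t ·_s x) = f(x)` and `D_t ·_s x = x + (t − 1)·y`
  have hval : ∀ t : ℂ, t ≠ 0 → Q.eval (t - 1) = evalT x f := by
    intro t ht
    have hD : Matrix.diagonal (fun a : Fin m => if m ≤ (a : ℕ) + N then (1 : ℂ) else t) ∈ borel m :=
      diagonal_mem_borel fun a => by
        by_cases hc : m ≤ (a : ℕ) + N
        · simp [hc]
        · simp [hc, ht]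
    have h1 := evalT_slotAct hf hD x s
    rw [weightChar_rectType_cornerDiagonal, one_mul, diagonal_corner_eq, slotAct_one_add_smul, ← hy, hQ] at h1
    exact h1
  -- the shifted polynomial `R(t) = Q(t − 1)` is constant on `ℂ^×`, hence everywhere (Laurent rigidity, constant partner)
  set R : Polynomial ℂ := Q.comp (Polynomial.X - Polynomial.C 1) with hR
  have hRe : ∀ t : ℂ, R.eval t = Q.eval (t - 1) := fun t => by
    simp only [hR, Polynomial.eval_comp, Polynomial.eval_sub, Polynomial.eval_X, Polynomial.eval_C]
  have hconst := (eval_eq_eval_zero_of_eval_inv_eq (P := Polynomial.C (evalT x f)) (Q := R)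
    (fun c hc => by rw [Polynomial.eval_C, hRe, hval c hc]) 0).2
  rw [Polynomial.eval_C, hRe, zero_sub, ← hQ] at hconst
  -- `x + (−1)·y = P ·_s x`
  have hx : x + (-1 : ℂ) • y = slotAct s (lastProj m N) x := by
    rw [hy, ← slotAct_one_add_smul, neg_one_smul, ← sub_eq_add_neg, sub_sub_cancel]
  rw [← hx, hconst]

/-- **Corner law.**  `f((P,P,P)·x) = f(x)` for every rectangular weight vector `f`: the value of a level-`k` weight vector
of format `N` at `x` depends only on the corner `N × N × N` block of `x`. [this node] -/
theorem evalT_cornerProj {N k d : ℕ} {f : MvPolynomial (Idx m) ℂ} (hf : f ∈ hwvSpace (rectType m N k) d)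
    (x : Tensor ℂ m) : evalT (actTensor (lastProj m N) (lastProj m N) (lastProj m N) x) f = evalT x f := by
  have h : actTensor (lastProj m N) (lastProj m N) (lastProj m N) x =
      slotAct 0 (lastProj m N) (slotAct 1 (lastProj m N) (slotAct 2 (lastProj m N) x)) := by
    simp only [slotAct_zero, slotAct_one, slotAct_two, actTensor_actTensor, Matrix.mul_one, Matrix.one_mul]
  rw [h, evalT_slotAct_lastProj hf 0, evalT_slotAct_lastProj hf 1, evalT_slotAct_lastProj hf 2]

/-- Hence the level set of a point is that of its corner block: `E'(x) = E'((P,P,P)·x)`. [this node] -/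
theorem pointLevels_cornerProj (N : ℕ) (x : Tensor ℂ m) :
    pointLevels N (actTensor (lastProj m N) (lastProj m N) (lastProj m N) x) = pointLevels N x := by
  ext k
  constructor
  · rintro ⟨f, hf, hne⟩
    exact ⟨f, hf, by rwa [evalT_cornerProj hf] at hne⟩
  · rintro ⟨f, hf, hne⟩
    exact ⟨f, hf, by rwa [evalT_cornerProj hf]⟩

/-- **Passing = witnessed (the witness principle is an equivalence).**  A level `k` passes at the cell `(m, N)` iff some
level-`k` weight vector is non-zero at a corner-supported point `[PA|PB|PC]` (a tensor of rank `≤ m` living in the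
corner format `N`): «`k ∈ passLevels m N ⟺ r_N(k) ≤ m`».  (⟸) is density `I(GL_m³·⟨m⟩) = I(Mat_m³·⟨m⟩)`
(`evalT_fromCols_eq_zero_of_mem_orbitVanishing`); (⟹) moves a surviving value from `(A,B,C)·⟨m⟩ = [A|B|C]` to its corner
by the corner law. [this node; cite: BurgisserIkenmeyer2011, Lemma 3.2] -/
theorem mem_passLevels_iff_exists_cornerCols (N k : ℕ) :
    k ∈ passLevels m N ↔ ∃ A B C : Matrix (Fin m) (Fin m) ℂ,
      k ∈ pointLevels N (fromCols (lastProj m N * A) (lastProj m N * B) (lastProj m N * C)) := by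
  constructor
  · intro hk
    by_contra h
    push Not at h
    refine hk fun f hf => ?_
    intro A B C _ _ _
    by_contra hne
    refine h A B C ⟨f, hf, ?_⟩
    rwa [← actTensor_fromCols, ← actTensor_unitTensor, evalT_cornerProj hf]
  · rintro ⟨A, B, C, f, hf, hne⟩ hle
    exact hne (evalT_fromCols_eq_zero_of_mem_orbitVanishing (hle hf) _ _ _)

/-- One-sided form used by the censuses: a level-`k` weight vector non-zero at ANY point `[A|B|C]` (rank `≤ m`, corner-
supported or not) certifies `k ∈ passLevels m N`. [this node] -/
theorem mem_passLevels_of_fromCols {N k : ℕ} (A B C : Matrix (Fin m) (Fin m) ℂ)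
    (h : k ∈ pointLevels N (fromCols A B C)) : k ∈ passLevels m N := by
  obtain ⟨f, hf, hne⟩ := h
  exact fun hle => hne (evalT_fromCols_eq_zero_of_mem_orbitVanishing (hle hf) _ _ _)

/-- And conversely every passing level is witnessed by a point `[A|B|C]` whose columns lie in the corner
(`P·A = A` etc.). [this node] -/
theorem exists_cornerCols_of_mem_passLevels {N k : ℕ} (hk : k ∈ passLevels m N) :
    ∃ A B C : Matrix (Fin m) (Fin m) ℂ, lastProj m N * A = A ∧ lastProj m N * B = B ∧ lastProj m N * C = C ∧
      k ∈ pointLevels N (fromCols A B C) := by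
  obtain ⟨A, B, C, h⟩ := (mem_passLevels_iff_exists_cornerCols N k).1 hk
  have hP : lastProj m N * lastProj m N = lastProj m N := by
    ext a b
    by_cases hab : a = b
    · subst hab
      by_cases hc : m ≤ (a : ℕ) + N <;> simp [lastProj, hc]
    · simp [lastProj, hab]
  exact ⟨_, _, _, by rw [← Matrix.mul_assoc, hP], by rw [← Matrix.mul_assoc, hP], by rw [← Matrix.mul_assoc, hP], h⟩

/-- Zero-padding the corner restriction of a corner-supported vector gives the vector back. [bookkeeping] -/
theorem padVec_val_corner (N : ℕ) (x : Fin m → ℂ) (hx : ∀ i : Fin m, ¬ m ≤ (i : ℕ) + N → x i = 0) :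
    padVec (Subtype.val : {a : Fin m // m ≤ (a : ℕ) + N} → Fin m) (fun a => x a.1) = x := by
  funext i
  unfold padVec
  by_cases hi : m ≤ (i : ℕ) + N
  · rw [Finset.sum_eq_single ⟨i, hi⟩]
    · simp
    · intro a _ ha
      have hne : (a : Fin m) ≠ i := fun h => ha (Subtype.ext h)
      simp [hne]
    · exact fun h => absurd (Finset.mem_univ _) h
  · rw [hx i hi]
    refine Finset.sum_eq_zero fun a _ => ?_
    have hne : (a : Fin m) ≠ i := fun h => hi (h ▸ a.2)
    simp [hne]

/-- The rows of `P·A` off the corner vanish (`P = lastProj m N`). [bookkeeping] -/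
theorem lastProj_mul_apply_of_not (N : ℕ) (A : Matrix (Fin m) (Fin m) ℂ) {i : Fin m} (hi : ¬ m ≤ (i : ℕ) + N)
    (l : Fin m) : (lastProj m N * A) i l = 0 := by
  simp [lastProj, Matrix.diagonal_mul, hi]

/-- **Passing = witnessed, in the `tensorRank` currency.**  With the corner format realised as the subtype
`{a : Fin m // m ≤ a + N}` (of size `min N m`): a level `k` passes at `(m, N)` iff some corner-format tensor `w` of
tensor rank `≤ m` carries it, `k ∈ E'(padTensor val w)` — literally «`k ∈ passLevels m N ⟺ r_N(k) ≤ m`».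
[this node; cite: BurgisserIkenmeyer2011, §2 (2.2), Lemma 3.2] -/
theorem mem_passLevels_iff_exists_tensorRank_le (N k : ℕ) :
    k ∈ passLevels m N ↔ ∃ w : {a : Fin m // m ≤ (a : ℕ) + N} → {a : Fin m // m ≤ (a : ℕ) + N} →
        {a : Fin m // m ≤ (a : ℕ) + N} → ℂ, tensorRank w ≤ m ∧ k ∈ pointLevels N (padTensor Subtype.val w) := by
  constructor
  · intro hk
    obtain ⟨A, B, C, h⟩ := (mem_passLevels_iff_exists_cornerCols N k).1 hk
    set A' := lastProj m N * A with hA'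
    set B' := lastProj m N * B with hB'
    set C' := lastProj m N * C with hC'
    have hw : (fun a b c : {a : Fin m // m ≤ (a : ℕ) + N} => fromCols A' B' C' a.1 b.1 c.1) =
        ∑ l, triad (fun a : {a : Fin m // m ≤ (a : ℕ) + N} => A' a.1 l) (fun b => B' b.1 l) (fun c => C' c.1 l) := by
      funext a b c
      simp only [fromCols, Finset.sum_apply, triad_apply]
    refine ⟨fun a b c => fromCols A' B' C' a.1 b.1 c.1, tensorRank_le_of_eq_sum _ _ _ hw, ?_⟩
    have hpad : padTensor Subtype.val (fun a b c : {a : Fin m // m ≤ (a : ℕ) + N} => fromCols A' B' C' a.1 b.1 c.1) =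
        fromCols A' B' C' := by
      rw [hw, padTensor_sum]
      refine Finset.sum_congr rfl fun l _ => ?_
      rw [padTensor_triad, padVec_val_corner N (fun a => A' a l) fun i hi => lastProj_mul_apply_of_not N A hi l,
        padVec_val_corner N (fun b => B' b l) fun i hi => lastProj_mul_apply_of_not N B hi l,
        padVec_val_corner N (fun c => C' c l) fun i hi => lastProj_mul_apply_of_not N C hi l]
    rwa [hpad]
  · rintro ⟨w, hr, hk⟩
    exact pointLevels_padTensor_subset_passLevels N Subtype.val hr hk

end CornerLaw

end Summit.MatrixMultiplication.MatrixMultiplication.Theorems.ObstructionCalculus
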